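import Summits.ABC.IUTFork.Thm311RealInd1StripOrbitSpan
import Literature.IUT.LogVolume.LogUnitsTraceZeroCoradial
import Literature.IUT.LogVolume.RescaledCompletionInvariants
import Literature.IUT.LogVolume.LocalDegreeGlobalBounds
import HarnessLib

/-!
# [IUTchIII] Thm 3.11 (i) (Ind1)+(Ind2) at `v ∈ 𝕍^non`: the `𝒪_{K_v}`-MODULE HULL of print's orbit span — the trace-line residue is
# WASHED OUT: at a TAME place of local degree `≥ 2` the ceiling `M + c·(log_p(𝒪_v^×) ∩ Ker Tr)` and Dupuy–Hilado's `c·log_p(𝒪_v^×)` have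
# THE SAME hull (UNCONDITIONAL)

PROOF-ONLY file (abc-iut cell, Cor. 3.12 sub-crew, seat abc-iut-c312-1 = holder of record of the typed [IUTchIII] Thm. 3.11, gen 15; row
«R19 = C:IND1-STRIP-OV-HULL» keyed by the C LEAD, `wake/KEY-abc-iut-c312-1-IND1OVHULL.md`, ruling C-R120 (c)).  TAKES NO SIDE on [IUTchIII] Cor. 3.12.

WHY.  [IUTchIII] Cor. 3.12 Step (xi) measures a Θ-region through its HOLOMORPHIC HULL ([IUTchIII] Rmk. 3.9.5 (i): «the smallest subset of the
form `λ·𝒪` … that contains `U`»; LANA §5.2 (d): «the smallest `𝒪`-submodule containing `S`»).  At ONE place `v` of `F` (one direct summand)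
this is the `𝒪_{K_v}`-submodule generated by the region — for a region with an element of maximal norm, the closed ball of that radius (§0).
Gen 14 measured the ADDITIVE SPAN of the orbit of a `ℤ_p`-region `M ⊆ c·log_p(𝒪_v^×)` under print's single-place indeterminacies AS TYPED by this
lineage ((Ind1) strip part `Real.ind1Strip`, (Ind2) `Real.ismIsm`): UNCONDITIONALLY inside the ceiling `M + c·(log_p(𝒪_v^×) ∩ Ker Tr_{K_v/ℚ_p})`
(`orbit_subset_add_of_mem_closure_ind`, p516833 §1), and — modulo the Jannsen–Wingberg facts, for regions in general position — EQUAL to it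
(p524057), whereas Dupuy–Hilado's container `Aut_{ℚ_p}(K_v : I_v)` generates all of `c·log_p(𝒪_v^×)` (abc-iut-w5-d180
`exists_closure_iUnion_ismDH_image_eq`); the difference is the trace-line residue `[Tr(c·log_p(𝒪_v^×)) : Tr(M)]`.  THIS FILE passes to hulls:

* §0 `coe_span_eq_closedBall_of_isGreatest` — over the valuation ring `𝒪 = {‖a‖ ≤ 1}` (any subring with that carrier; for `K_v^{(1/n_v)}`:
  Mathlib's `Valued.integer`, `valuedInteger_norm_le_one` / `mem_valuedInteger_of_norm_le_one`) the `𝒪`-span of a set `S` having an element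
  of maximal norm `r` IS `closedBall 0 r` — the single-summand holomorphic hull; so hulls of such sets are compared by their RADII;
* §1 (UNCONDITIONAL, `p > 2`, `e(v|p) ≤ p − 2` — [IUTchIV] Prop. 1.2 (i)'s tame case, `log_p(𝒪_v^×) = 𝔪_v` — and `[K_v:ℚ_p] ≥ 2`)
  `isGreatest_norm_smul_logUnits_of_tame`: the container span `c·log_p(𝒪_v^×)` has maximal norm `‖c‖·p^{−1/e}`;
  **`isGreatest_norm_add_inter_ker_of_tame`**: for EVERY region `0 ∈ M ⊆ c·log_p(𝒪_v^×)` the ceiling `M + (c·log_p(𝒪_v^×) ∩ Ker Tr)` has THE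
  SAME maximal norm — because the trace-zero sublattice is CO-RADIAL (`Literature…TraceZeroCoradial.exists_mem_logUnits_trace_eq_zero_isMaxOn_of_tame`:
  `w = ϖ − Tr(ϖ)·z₁` for `e ≥ 2`, `w = p·(trace-zero unit)` for `e = 1`, `f ≥ 2`); hence **`coe_span_add_inter_ker_eq_of_tame`**: the two
  `𝒪_{K_v}`-hulls COINCIDE (`= closedBall 0 (‖c‖·p^{−1/e})`): the trace-line residue has hull index ONE — it is washed out;
  `norm_of_apply_le_of_mem_closure_ind` / `of_apply_mem_span_of_mem_closure_ind`: consequently every element of the print-(Ind1)⊔(Ind2) orbit of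
  such a region lies in the container's hull ball (the hull form of the upper bound; cf. `LDHGenuinePerImagePrintInd1`, p516014);
* §2 the two NAMED residues where §1 is silent: `trace_eq_zero_iff_eq_zero_of_localDeg_eq_one` — at `[K_v:ℚ_p] = 1` the trace-zero part is `{0}`
  (the ceiling is `M` itself: hull(print orbit) = hull(`M`), which is the container's hull iff `M` already has an element of content-`c` maximal
  norm; there the strip part is trivial anyway, p453109); WILD places `e(v|p) ≥ p − 1` are not treated (co-radiality can fail: `ℚ₂(√−1)` has
  `𝔪 ∩ Ker Tr ⊆ 𝔪²`).
READING (numbers about OUR typed objects, one finite place): at the level print's Step (xi) actually uses — `𝒪_{K_v}`-module hulls — the trace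
rigidity of print's (Ind1) strip part (R13) leaves NO residue at a tame place of local degree `≥ 2`: the ceiling of the print-(Ind1)⊔(Ind2) orbit
span and Dupuy–Hilado's container span have the same hull, UNCONDITIONALLY; so no hull saving relative to the container can come from the ceiling,
and wherever the orbit span reaches its ceiling (general-position regions, modulo the Jannsen–Wingberg facts: the sequel `Thm311RealInd1StripHullFloor`)
print's single-place hull IS the container's.  HONEST SCOPE: single place; tame; OUR typing of print's (Ind1)/(Ind2) (THE equivariant lift, THE
logarithm; referee F-B28-1's matter untouched); nothing here computes a tensor-packet hull or a log-volume; (Ind3) and the log-link untouched;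
no side taken on [IUTchIII] Cor. 3.12; NO abc claim. [claim: Mochizuki2012, status: disputed]; [cite: Mochizuki2012, IUTchIII Rmk. 3.9.5 (i)
p. 126–128; Thm. 3.11 (i) p. 154; Cor. 3.12 Step (xi) p. 183; IUTchIV Prop. 1.2 (i) p. 10]; [cite: DupuyHilado2025, §4.9, §4.12];
[cite: SerreLocalFields1979, Ch. III §6, Prop. 13]. typed ≠ proved; a conditional theorem discharges nothing it binds.
-/

set_option autoImplicit false

noncomputable section

open Metric Set
open scoped Pointwise

/-! ## §0 The `𝒪`-hull of a set with an element of maximal norm is the ball of that radius -/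

namespace Summit.ABC.IUTFork.Thm311.Real.Hull

variable {K : Type} [NontriviallyNormedField K] [IsUltrametricDist K]

/-- **The `𝒪`-module hull of a set with an element of maximal norm `r` is `closedBall 0 r`** — for any subring `O ⊆ K` whose carrier is the
closed unit ball (the valuation ring): `𝒪`-combinations do not increase the maximal norm (ultrametric), and every `x` with `‖x‖ ≤ ‖s₀‖`,
`s₀ ∈ S` of maximal norm, is `(x/s₀)·s₀` with `x/s₀ ∈ 𝒪`.  This is the one-summand case of [IUTchIII] Rmk. 3.9.5 (i) «the smallest subset
of the form `λ·𝒪` that contains `U`» (tree: `Literature.IUT.LogVolume.holomorphicHull`). [cite: Mochizuki2012, IUTchIII Rmk. 3.9.5 (i) p. 126]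
[claim: Mochizuki2012, status: disputed] -/
theorem coe_span_eq_closedBall_of_isGreatest (O : Subring K) (hO : ∀ a : O, ‖(a : K)‖ ≤ 1)
    (hO' : ∀ a : K, ‖a‖ ≤ 1 → a ∈ O) {S : Set K} {r : ℝ} (hS : IsGreatest ((‖·‖) '' S) r) :
    (Submodule.span O S : Set K) = closedBall (0 : K) r := by
  obtain ⟨⟨s₀, hs₀, hr⟩, hub⟩ := hS
  change ‖s₀‖ = r at hr
  subst hr
  apply Set.Subset.antisymm
  · intro x hx
    rw [mem_closedBall, dist_zero_right]
    induction hx using Submodule.span_induction with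
    | mem y hy => exact hub ⟨y, hy, rfl⟩
    | zero => rw [norm_zero]; exact norm_nonneg _
    | add y z _ _ hy hz => exact (IsUltrametricDist.norm_add_le_max y z).trans (max_le hy hz)
    | smul a y _ hy =>
      rw [Subring.smul_def, smul_eq_mul, norm_mul]
      calc ‖(a : K)‖ * ‖y‖ ≤ 1 * ‖y‖ := mul_le_mul_of_nonneg_right (hO a) (norm_nonneg _)
        _ ≤ ‖s₀‖ := by rw [one_mul]; exact hy
  · intro x hx
    rw [mem_closedBall, dist_zero_right] at hx
    by_cases h0 : s₀ = 0
    · rw [h0, norm_zero] at hx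
      have hx0 : x = 0 := norm_le_zero_iff.mp hx
      rw [hx0]
      exact (Submodule.span O S).zero_mem
    · have hs0 : 0 < ‖s₀‖ := norm_pos_iff.mpr h0
      have ha : ‖x / s₀‖ ≤ 1 := by
        rw [norm_div, div_le_one hs0]; exact hx
      have hx' : x = (⟨x / s₀, hO' _ ha⟩ : O) • s₀ := by
        rw [Subring.smul_def, smul_eq_mul]
        change x = x / s₀ * s₀
        rw [div_mul_cancel₀ x h0]
      rw [hx']
      exact (Submodule.span O S).smul_mem _ (Submodule.subset_span hs₀)

/-- Two sets with elements of the SAME maximal norm have the same `𝒪`-hull. [cite: Mochizuki2012, IUTchIII Rmk. 3.9.5 (i) p. 126]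
[claim: Mochizuki2012, status: disputed] -/
theorem coe_span_eq_coe_span_of_isGreatest (O : Subring K) (hO : ∀ a : O, ‖(a : K)‖ ≤ 1)
    (hO' : ∀ a : K, ‖a‖ ≤ 1 → a ∈ O) {S T : Set K} {r : ℝ} (hS : IsGreatest ((‖·‖) '' S) r)
    (hT : IsGreatest ((‖·‖) '' T) r) :
    (Submodule.span O S : Set K) = Submodule.span O T := by
  rw [coe_span_eq_closedBall_of_isGreatest O hO hO' hS, coe_span_eq_closedBall_of_isGreatest O hO hO' hT]

end Summit.ABC.IUTFork.Thm311.Real.Hull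

namespace Summit.ABC.IUTFork.Thm311.Real

open NumberField IsDedekindDomain Literature.NumberTheory.NumberFields Literature.IUT.LogVolume
open Literature.NumberTheory.GaloisRepresentations Literature.NumberTheory.GaloisRepresentations.Ultrametric
open Literature.AnabelianGeometry.AbsoluteAnabelian Literature.IUT.HodgeArakelov
open Literature.IUT.HodgeArakelov.AbsTopMonoids Literature.IUT.LogThetaLattice

variable {F : Type} [Field F] [NumberField F] (v : HeightOneSpectrum (𝓞 F))
variable (p : ℕ) [hp : Fact p.Prime] (hv : ((p : ℕ) : 𝓞 F) ∈ v.asIdeal)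

/-! ## The valuation ring of `K_v^{(1/n_v)}` is the closed unit ball -/

omit hp in
/-- Elements of Mathlib's valuation ring `Valued.integer` of the rescaled completion have norm `≤ 1`. [folklore] -/
theorem valuedInteger_norm_le_one (a : Valued.integer (RescaledCompletion F p v hv)) :
    ‖(a : RescaledCompletion F p v hv)‖ ≤ 1 :=
  Valued.toNormedField.norm_le_one_iff.mpr ((Valuation.mem_integer_iff _ _).mp a.2)

omit hp in
/-- … and every element of norm `≤ 1` lies in it. [folklore] -/
theorem mem_valuedInteger_of_norm_le_one {a : RescaledCompletion F p v hv} (ha : ‖a‖ ≤ 1) :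
    a ∈ Valued.integer (RescaledCompletion F p v hv) :=
  (Valuation.mem_integer_iff _ _).mpr (Valued.toNormedField.norm_le_one_iff.mp ha)

/-! ## §1 UNCONDITIONAL: at a tame place of local degree `≥ 2` the ceiling and the container have the same hull -/

section Tame

variable (hp2 : 2 < p) (he : absRamificationIdx p (RescaledCompletion F p v hv) ≤ p - 2) (hd : 2 ≤ localDeg F v)
include hp2 he hd

/-- **The container's hull radius.**  At a tame place `v ∣ p` (`p > 2`, `e(v|p) ≤ p − 2`; `absRamificationIdx_rescaledCompletion`: the
norm-defined `e` of `K_v^{(1/n_v)}` IS `e(v|p)`) of local degree `≥ 2`, the set `c·log_p(𝒪_v^×)` — the additive span of the orbit of any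
content-`c` region under Dupuy–Hilado's `Aut_{ℚ_p}(K_v : I_v)` (abc-iut-w5-d180 `exists_closure_iUnion_ismDH_image_eq`) — attains its maximal
norm `‖c‖·p^{−1/e}` (at `c·w`, `w` the co-radial trace-zero element). [cite: Mochizuki2012, IUTchIV Prop. 1.2 (i) p. 10]
[cite: DupuyHilado2025, §4.9] [claim: Mochizuki2012, status: disputed] -/
theorem isGreatest_norm_smul_logUnits_of_tame (c : ℚ_[p]) :
    IsGreatest ((‖·‖) '' (c • logUnits (RescaledCompletion F p v hv)))
      (‖c‖ * (p : ℝ) ^ (-(1 / (absRamificationIdx p (RescaledCompletion F p v hv) : ℝ)))) := by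
  have hd' : 2 ≤ Module.finrank ℚ_[p] (RescaledCompletion F p v hv) := by
    rwa [finrank_rescaledCompletion_eq_localDeg]
  obtain ⟨w, hwL, -, hw, hmax⟩ :=
    TraceZeroCoradial.exists_mem_logUnits_trace_eq_zero_isMaxOn_of_tame p (RescaledCompletion F p v hv) hp2 he hd'
  refine ⟨⟨c • w, Set.smul_mem_smul_set hwL, by change ‖c • w‖ = _; rw [norm_smul, hw]⟩, ?_⟩
  rintro _ ⟨_, ⟨z, hz, rfl⟩, rfl⟩
  change ‖c • z‖ ≤ _
  rw [norm_smul, ← hw]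
  exact mul_le_mul_of_nonneg_left (hmax z hz) (norm_nonneg c)

/-- **THE CEILING HAS THE CONTAINER's HULL RADIUS (UNCONDITIONAL).**  At a tame place `v ∣ p` of local degree `≥ 2`, for EVERY `c ∈ ℚ_p` and
EVERY region `M ⊆ c·log_p(𝒪_v^×)` containing `0`, the ceiling `M + (c·log_p(𝒪_v^×) ∩ Ker Tr_{K_v/ℚ_p})` of the print-(Ind1)⊔(Ind2) orbit span
of `M` (p516833 §1) attains the maximal norm `‖c‖·p^{−1/e}` of the container span `c·log_p(𝒪_v^×)`: the trace-zero sublattice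
`log_p(𝒪_v^×) ∩ Ker Tr` is CO-RADIAL in `log_p(𝒪_v^×)` (`TraceZeroCoradial.exists_mem_logUnits_trace_eq_zero_isMaxOn_of_tame`).
[cite: Mochizuki2012, IUTchIII Thm. 3.11 (i) p. 154; IUTchIV Prop. 1.2 (i) p. 10] [cite: SerreLocalFields1979, Ch. III §6, Prop. 13]
[claim: Mochizuki2012, status: disputed] -/
theorem isGreatest_norm_add_inter_ker_of_tame (c : ℚ_[p]) {M : Set (RescaledCompletion F p v hv)}
    (h0 : (0 : RescaledCompletion F p v hv) ∈ M) (hM : M ⊆ c • logUnits (RescaledCompletion F p v hv)) :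
    IsGreatest ((‖·‖) '' (M + (c • logUnits (RescaledCompletion F p v hv) ∩
        {w | Algebra.trace ℚ_[p] (RescaledCompletion F p v hv) w = 0})))
      (‖c‖ * (p : ℝ) ^ (-(1 / (absRamificationIdx p (RescaledCompletion F p v hv) : ℝ)))) := by
  have hd' : 2 ≤ Module.finrank ℚ_[p] (RescaledCompletion F p v hv) := by
    rwa [finrank_rescaledCompletion_eq_localDeg]
  obtain ⟨w, hwL, htr, hw, hmax⟩ :=
    TraceZeroCoradial.exists_mem_logUnits_trace_eq_zero_isMaxOn_of_tame p (RescaledCompletion F p v hv) hp2 he hd'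
  have hcL : ∀ x ∈ c • logUnits (RescaledCompletion F p v hv), ‖x‖ ≤ ‖c‖ * ‖w‖ := by
    rintro _ ⟨z, hz, rfl⟩
    rw [norm_smul]
    exact mul_le_mul_of_nonneg_left (hmax z hz) (norm_nonneg c)
  refine ⟨⟨0 + c • w, ⟨0, h0, c • w, ⟨Set.smul_mem_smul_set hwL, ?_⟩, rfl⟩, ?_⟩, ?_⟩
  · change Algebra.trace ℚ_[p] (RescaledCompletion F p v hv) (c • w) = 0
    rw [map_smul, htr, smul_zero]
  · change ‖(0 : RescaledCompletion F p v hv) + c • w‖ = _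
    rw [zero_add, norm_smul, hw]
  · rintro _ ⟨_, ⟨m, hm, y, ⟨hy, -⟩, rfl⟩, rfl⟩
    change ‖m + y‖ ≤ _
    rw [← hw]
    exact (IsUltrametricDist.norm_add_le_max m y).trans (max_le (hcL m (hM hm)) (hcL y hy))

/-- **THE TRACE-LINE RESIDUE IS WASHED OUT BY THE HULL (UNCONDITIONAL).**  At a tame place `v ∣ p` of local degree `≥ 2`, for every
`c ∈ ℚ_p` and every region `0 ∈ M ⊆ c·log_p(𝒪_v^×)`: the `𝒪_{K_v}`-module hull of the ceiling `M + (c·log_p(𝒪_v^×) ∩ Ker Tr)` of print's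
(Ind1)⊔(Ind2) orbit span EQUALS the `𝒪_{K_v}`-module hull of Dupuy–Hilado's container span `c·log_p(𝒪_v^×)` — both are the ball of radius
`‖c‖·p^{−1/e}`; the radial index `[Tr(c·log_p(𝒪_v^×)) : Tr(M)]` by which the two additive spans differ (gen 14) has hull index ONE.
[cite: Mochizuki2012, IUTchIII Rmk. 3.9.5 (i) p. 126; Thm. 3.11 (i) p. 154; Cor. 3.12 Step (xi) p. 183] [cite: DupuyHilado2025, §4.9, §4.12]
[claim: Mochizuki2012, status: disputed] -/
theorem coe_span_add_inter_ker_eq_of_tame (c : ℚ_[p]) {M : Set (RescaledCompletion F p v hv)}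
    (h0 : (0 : RescaledCompletion F p v hv) ∈ M) (hM : M ⊆ c • logUnits (RescaledCompletion F p v hv)) :
    (Submodule.span (Valued.integer (RescaledCompletion F p v hv))
        (M + (c • logUnits (RescaledCompletion F p v hv) ∩ {w | Algebra.trace ℚ_[p] (RescaledCompletion F p v hv) w = 0})) :
        Set (RescaledCompletion F p v hv)) =
      Submodule.span (Valued.integer (RescaledCompletion F p v hv)) (c • logUnits (RescaledCompletion F p v hv)) ∧
    (Submodule.span (Valued.integer (RescaledCompletion F p v hv)) (c • logUnits (RescaledCompletion F p v hv)) :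
        Set (RescaledCompletion F p v hv)) =
      closedBall 0 (‖c‖ * (p : ℝ) ^ (-(1 / (absRamificationIdx p (RescaledCompletion F p v hv) : ℝ)))) :=
  ⟨Hull.coe_span_eq_coe_span_of_isGreatest _ (valuedInteger_norm_le_one v p hv) (fun _ h => mem_valuedInteger_of_norm_le_one v p hv h)
      (isGreatest_norm_add_inter_ker_of_tame v p hv hp2 he hd c h0 hM) (isGreatest_norm_smul_logUnits_of_tame v p hv hp2 he hd c),
    Hull.coe_span_eq_closedBall_of_isGreatest _ (valuedInteger_norm_le_one v p hv) (fun _ h => mem_valuedInteger_of_norm_le_one v p hv h)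
      (isGreatest_norm_smul_logUnits_of_tame v p hv hp2 he hd c)⟩

/-- **Hull form of the upper bound for print's orbit (UNCONDITIONAL).**  At a tame place of local degree `≥ 2`: for every `γ` in the subgroup
generated by print's (Ind1) strip part `Real.ind1Strip (analyticLogv F) v` and print's (Ind2) `Real.ismIsm (analyticLogv F) v`, every
`ℤ_p`-stable region `M ⊆ c·log_p(𝒪_v^×)` and `x ∈ M`: `‖γ x‖ ≤ ‖c‖·p^{−1/e}` — the orbit stays in the container's hull ball (p516833 §1 + the
ceiling radius). [cite: Mochizuki2012, IUTchIII Thm. 3.11 (i) p. 154] [cite: DupuyHilado2025, §4.9] [claim: Mochizuki2012, status: disputed] -/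
theorem norm_of_apply_le_of_mem_closure_ind
    {γ : Carrier (.inr v : Place F) ≃ₗ[ℚ] Carrier (.inr v : Place F)}
    (hγ : γ ∈ Subgroup.closure (ind1Strip (analyticLogv F) v ∪ ismIsm (analyticLogv F) v)) (c : ℚ_[p])
    (M : AddSubgroup (RescaledCompletion F p v hv))
    (hMs : ∀ u : ℚ_[p], ‖u‖ ≤ 1 → ∀ z ∈ M, u • z ∈ M)
    (hM : (M : Set (RescaledCompletion F p v hv)) ⊆ c • logUnits (RescaledCompletion F p v hv))
    {x : v.adicCompletion F} (hx : RescaledCompletion.of F p v hv x ∈ M) :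
    ‖RescaledCompletion.of F p v hv (γ x)‖ ≤
      ‖c‖ * (p : ℝ) ^ (-(1 / (absRamificationIdx p (RescaledCompletion F p v hv) : ℝ))) :=
  (isGreatest_norm_add_inter_ker_of_tame v p hv hp2 he hd c M.zero_mem hM).2
    ⟨_, orbit_subset_add_of_mem_closure_ind v p hv hγ c M hMs hM hx, rfl⟩

/-- … equivalently: the print-(Ind1)⊔(Ind2) orbit of `M` lies in the `𝒪_{K_v}`-hull of the container span `c·log_p(𝒪_v^×)`.
[cite: Mochizuki2012, IUTchIII Thm. 3.11 (i) p. 154; Rmk. 3.9.5 (i) p. 126] [claim: Mochizuki2012, status: disputed] -/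
theorem of_apply_mem_span_of_mem_closure_ind
    {γ : Carrier (.inr v : Place F) ≃ₗ[ℚ] Carrier (.inr v : Place F)}
    (hγ : γ ∈ Subgroup.closure (ind1Strip (analyticLogv F) v ∪ ismIsm (analyticLogv F) v)) (c : ℚ_[p])
    (M : AddSubgroup (RescaledCompletion F p v hv))
    (hMs : ∀ u : ℚ_[p], ‖u‖ ≤ 1 → ∀ z ∈ M, u • z ∈ M)
    (hM : (M : Set (RescaledCompletion F p v hv)) ⊆ c • logUnits (RescaledCompletion F p v hv))
    {x : v.adicCompletion F} (hx : RescaledCompletion.of F p v hv x ∈ M) :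
    RescaledCompletion.of F p v hv (γ x) ∈
      (Submodule.span (Valued.integer (RescaledCompletion F p v hv)) (c • logUnits (RescaledCompletion F p v hv)) :
        Set (RescaledCompletion F p v hv)) := by
  rw [(coe_span_add_inter_ker_eq_of_tame v p hv hp2 he hd c M.zero_mem hM).2, mem_closedBall, dist_zero_right]
  exact norm_of_apply_le_of_mem_closure_ind v p hv hp2 he hd hγ c M hMs hM hx

end Tame

/-! ## §2 The named residue at local degree one -/

/-- **At `[K_v:ℚ_p] = 1` the trace-zero part is `{0}`**: `Tr_{K_v/ℚ_p}` is injective (`K_v^{(1/n_v)} = ℚ_p·1`, `Tr(a·1) = a`), so the ceiling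
`M + (c·log_p(𝒪_v^×) ∩ Ker Tr)` is `M` itself and the hull of print's (Ind1)⊔(Ind2) orbit span is the hull of `M` — the container's iff `M`
already contains an element of maximal norm `‖c‖·p^{−1}`; consistently, print's (Ind1) strip part is trivial at local degree one (this
lineage, p453109). [folklore] [claim: Mochizuki2012, status: disputed] -/
theorem trace_eq_zero_iff_eq_zero_of_localDeg_eq_one (hd : localDeg F v = 1) (w : RescaledCompletion F p v hv) :
    Algebra.trace ℚ_[p] (RescaledCompletion F p v hv) w = 0 ↔ w = 0 := by
  have hd' : Module.finrank ℚ_[p] (RescaledCompletion F p v hv) = 1 := by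
    rw [finrank_rescaledCompletion_eq_localDeg, hd]
  haveI : FiniteDimensional ℚ_[p] (RescaledCompletion F p v hv) := FiniteDimensional.of_locallyCompactSpace ℚ_[p]
  constructor
  · intro h
    obtain ⟨a, rfl⟩ : ∃ a : ℚ_[p], a • (1 : RescaledCompletion F p v hv) = w :=
      (finrank_eq_one_iff_of_nonzero' (1 : RescaledCompletion F p v hv) one_ne_zero).mp hd' w
    have h1 : Algebra.trace ℚ_[p] (RescaledCompletion F p v hv) 1 = 1 := by
      rw [← map_one (algebraMap ℚ_[p] (RescaledCompletion F p v hv)), Algebra.trace_algebraMap, hd', one_smul]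
    rw [map_smul, h1, smul_eq_mul, mul_one] at h
    rw [h, zero_smul]
  · rintro rfl
    rw [map_zero]

/-- Hence at local degree one the ceiling of the print-(Ind1)⊔(Ind2) orbit span of a region `M ∋ 0` is `M` itself.
[cite: Mochizuki2012, IUTchIII Thm. 3.11 (i) p. 154] [claim: Mochizuki2012, status: disputed] -/
theorem add_inter_ker_eq_self_of_localDeg_eq_one (hd : localDeg F v = 1) (c : ℚ_[p])
    (M : AddSubgroup (RescaledCompletion F p v hv)) :
    (M : Set (RescaledCompletion F p v hv)) + (c • logUnits (RescaledCompletion F p v hv) ∩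
        {w | Algebra.trace ℚ_[p] (RescaledCompletion F p v hv) w = 0}) = M := by
  apply Set.Subset.antisymm
  · rintro _ ⟨m, hm, y, ⟨-, hy⟩, rfl⟩
    have hy0 : y = 0 := (trace_eq_zero_iff_eq_zero_of_localDeg_eq_one v p hv hd y).mp hy
    change m + y ∈ (M : Set (RescaledCompletion F p v hv))
    rw [hy0, add_zero]; exact hm
  · intro m hm
    refine ⟨m, hm, 0, ⟨?_, ?_⟩, add_zero m⟩
    · rw [← smul_zero c]; exact Set.smul_mem_smul_set (zero_mem_logUnits (p := p))
    · change Algebra.trace ℚ_[p] (RescaledCompletion F p v hv) 0 = 0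
      rw [map_zero]

end Summit.ABC.IUTFork.Thm311.Real

end
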